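/-
Copyright: the b2b-balaban T⁴-continuum CRUX team, row NE7b OWNER lineage `t4-ne7b-p1` (gen 135). Project licence.
-/
import Summits.QuantumFields.BalabanUV.T4Continuum.Spine.NE7b.SupNextSingletonRegulated
import Summits.QuantumFields.BalabanUV.T4Continuum.Spine.NE7b.SupTwoLetterShift

/-!
# THE TWO-LETTER FORMAT CLOSES UNDER THE ROAD'S STEP WITH A NORMALISATION — NO RATE DOUBLING, NO `e^{κΨ²}`: input singleton factors with
#   (S) `‖f_X(ζ)‖ ≤ ε` for `Σ_{cells X}ζ² ≤ h²`   and   (L1) `‖1 + f_X(ζ)‖ ≤ e^{½κ₀Σ_{cells X}ζ²}` for all `ζ` (constant ONE, small rate `κ₀`),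
# larger sets sup-small `ε^{#X}`; the Gaussian road `N(0,Γ)` with a FRESH rate `κ ≥ κ₀(1+τ)`, `κγ_op ≤ θ` (the expansion's regulator) and the stability
# margin `κ₀(1+τ)γ_op ≤ θ₀`.  Then the NORMALISED next single-block factor `g̃⁺_D(ψ) := Z_ψ(𝒜)∕N_D − 1`, `N_D := S₂·A₀^{#cells D} ≥ 1`
# (`S₂ = ∏_{#X≥2}(1 + ε^{#X})`, `A₀ = (1−θ₀)^{−κ₀(1+τ)γ∕(2θ₀)}` — a field-independent number: vacuum-energy bookkeeping), has the SAME two letters: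
#   (L1⁺) `‖1 + g̃⁺_D(ψ)‖ ≤ e^{½κ₀(1+τ⁻¹)Σ_{cells D}ψ²}` for EVERY `ψ` — constant ONE again, rate `κ₀ ↦ κ₀(1+τ⁻¹)` (small stays small),
#   (S⁺)  `‖g̃⁺_D(ψ)‖ ≤ 2η + (1 − N_D⁻¹)` for `ψ` with `Σ_{cells X}ψ² ≤ Ψ²` on the singleton members, `Ψ ≤ h`, where `η = #(⋃𝒜)(Δ+1)2e·ε₁`,
#         `ε₁ = 2e(Δ+1)²·ε_shift·A^v` and `ε_shift = ε + 2e^{½κ₀(1+τ⁻¹)Ψ²}e^{−½(κ−κ₀(1+τ))(h−Ψ)²}` ((376)): NO `e^{κΨ²}` blow-up and NO condition tying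
#         `κ` to an inherited rate; the large-field penalty lives in `ε_shift`'s second term at the FRESH rate, the stability growth costs only
#         `1 − N_D⁻¹ ≤ log N_D = log S₂ + #cells·log A₀ = O(bε² + κ₀(1+τ)γ·vb)`;
# and under a SMOOTHNESS letter of the next field on the finer cells (`Σ_{cells X}ψ² ≤ σ·Σ_{cells D}ψ²` for the singleton members `X ⊆ D`) the region
# of (S⁺) contains the next small-field BALL `Σ_{cells D}ψ² ≤ Ψ²∕σ` — (α3)'s input displayed: SCOPING-d7 (α2)+(α4) typed, (α3) located as one letter
# (row NE7b, node U5c; (371)∕(376)∕(353)∕(357) BY NAME; [folklore])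

Cell `pub-balaban`, sub-cell `t4`, spine estimate NE7b (`T4WeightBudget.RelWeightBound`; the cell's OWN estimate — NOT PRINTED in
[Bałaban 1983–89], NOT PROVED).  Crux-route work under `Spine/NE7b/` by the row OWNER (`t4-ne7b-p1` gen 135, file (377)) under FREEZE
(0)'s crux-prover clause, on this gen's SCOPING-d7 (α2)∕(α4); NOTHING of Bałaban's is named as a Lean object, valued or asserted; no `T4Continuum/Support`
leaf typed; no `def`, no notation; zero `sorry`.  Imports (BY NAME): the OWNER's (371) `…SupNextSingletonRegulated` (`norm_one_add_le`,
`norm_one_add_shifted_sup_le`, `singletonCells_subset`; through it (355) `cutoff_shifted_measurable_sets`, (353) `gaussian_set_hypotheses`, (357)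
`exp_setLogZ_linear` ∕ `norm_setLogZ_le_linear`, (351) `biUnion_cells_pairwiseDisjoint`, (296) `pertZ_cutoff`, (292) `sum_add_sq_le`, (289)
`one_le_regulatorCost`, (288) `integral_exp_half_sq_on_le` ∕ `integrable_exp_half_sq_on`), (376) `…SupTwoLetterShift` (`twoLetter_shift_regulated`,
`eps_shift_nonneg`); Mathlib's `Complex.norm_exp_sub_one_le`, `Finset.prod_filter_mul_prod_filter_not`.

WHAT IS PROVED ([folklore]; `Q_X(ζ) := Σ_{x∈cells X}ζ_x²`, `𝒜₁` the singleton members, `U` their cells, `S₂ := ∏_{X∈𝒜,#X≠1}(1 + ε^{#X})`):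
* §1 letters: `norm_le_two_mul_of_stability` ((L1) ⟹ (L) with `M = 2`), `cutoff_twoLetter_reg` ∕ `cutoff_twoLetter_sup` (the cut-off shifted factors
  are regulated IN `ω` with the fresh `(ε_shift, κ)` — (376) — and sup-small with `ε_shift^{#X}`);
* §2 STABILITY WITH CONSTANT ONE: `norm_prod_one_add_shifted_le_twoLetter` (pointwise: `‖∏(1+f_X(ω+ψ))‖ ≤ S₂e^{½κ₀(1+τ⁻¹)Q_U(ψ)}e^{½κ₀(1+τ)Q_U(ω)}`),
  **`norm_pertZ_shifted_le_twoLetter`** (`‖Z_ψ(𝒜)‖ ≤ S₂·A₀^{#cells D}·e^{½κ₀(1+τ⁻¹)Q_D(ψ)}` for EVERY `ψ`);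
* §3 SMALL FIELDS WITHOUT `e^{κΨ²}`: **`norm_pertZ_shifted_sub_one_le_twoLetter`** (`‖Z_ψ(𝒜) − 1‖ ≤ 2η` with `ε_shift` in place of (371)'s `ε_Ψ`);
* §4 THE END — THE NORMALISED NEXT FACTOR HAS THE SAME TWO LETTERS: `one_le_normaliser`, **`nextTwoLetter_L1`** ((L1⁺), every `ψ`),
  **`nextTwoLetter_S`** ((S⁺)), `nextTwoLetter_S_of_smooth` ((S⁺) on the next ball under the smoothness letter); §5 toy.

HONEST (what this is NOT).  (i) The normaliser `N_D` is the CRUDE stability constant, not the true `Z_0(𝒜)`: the mismatch `1 − N_D⁻¹` enters `ε⁺`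
additively — `O(bε²)` from the non-singletons and `O(κ₀(1+τ)γ·vb)` from the stability growth's Gaussian cost; along the scales these and `2η_j` must be
SUMMABLE for the letters to stay small: CONTRACTION of `η_j` (extraction of the local relevant parts + rescaling — the renormalisation group proper,
(α4)) is NOT supplied here.  (ii) The smoothness letter of §4 is a HYPOTHESIS ((α3)): the lineage's fibre∕background machinery ((56)∕(60)∕(61)∕
(270)–(286): coarse fluctuation fields lie in the range of a smoothing kernel) is where it must come from; with `σ ≍ 1∕b` the radius grows by `√b`
per step, enough to beat (376)'s window decrement — not typed.  (iii) The rate still creeps by `(1+τ_j⁻¹)` per step (Young at the small rate); with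
`Στ_j⁻¹ < ∞` the product converges, at the price `κ₀∏(1+τ_j) ≤` the stability margin — finite depth again unless (α3)'s orthogonal fibre split
removes Young altogether.  Scalar skeleton ((A3), NC-NE7b-α UNRULED); nothing of Bałaban's asserted.  BY-NAME EFFECT ON THE WALL: NONE.  NE7b NOT
PRINTED ∕ NOT PROVED; spine PROVED 0∕9; rung (B)+1 — the programme's measures remain FINITE-torus statements; NOT the mass gap, NOT Clay.  HONEST
DEPENDENCY: continuum YM on T⁴ ⇐ BetaPertH ∧ nine spine estimates (0∕9 proved); BetaPertH ⇐ (D1) ∧ (D4) ∧ CAP+tail; G-an2-4 gates asym, D1 and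
NE2∕3∕4.
-/

set_option autoImplicit false

noncomputable section

namespace Summit.QuantumFields.BalabanUV.T4Continuum.NE7b.SupTwoLetterNextFactor

open MeasureTheory ProbabilityTheory Finset Real
open scoped BigOperators
open Literature.Probability.LatticeModels
open Literature.Analysis.Matrix (HasFiniteRange)
open SupLocalisedPolymerGas (pertZ_cutoff)
open SupPolymerLocalStep (cutoff_shifted_measurable_sets)
open SupPolymerLocalExpansion (gaussian_set_hypotheses)
open SupPolymerLocalSmallnessLinear (exp_setLogZ_linear norm_setLogZ_le_linear)
open SupPolymerLocalActivityBound (biUnion_cells_pairwiseDisjoint)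
open SupRegulatedActivityShift (sum_add_sq_le)
open SupRegulatedActivityBound (one_le_regulatorCost)
open SupGaussianRegulator (integral_exp_half_sq_on_le integrable_exp_half_sq_on)
open SupNextSingletonRegulated (norm_one_add_le norm_one_add_shifted_sup_le singletonCells_subset)
open SupTwoLetterShift (twoLetter_shift_regulated eps_shift_nonneg)

variable {V : Type*} [DecidableEq V] {R : V → V → Prop} [DecidableRel R] {nbr : V → Finset V} {Δ : ℕ}
variable {ι : Type} [Fintype ι] [DecidableEq ι]

/-! ## §1. The letters -/

omit [DecidableEq V] [DecidableRel R] [Fintype ι] [DecidableEq ι] in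
/-- **(L1) ⟹ (L) with `M = 2`**: `‖1 + z‖ ≤ E` with `1 ≤ E` ⟹ `‖z‖ ≤ 2E`. [folklore] -/
theorem norm_le_two_mul_of_stability {z : ℂ} {E : ℝ} (h : ‖1 + z‖ ≤ E) (hE : 1 ≤ E) : ‖z‖ ≤ 2 * E := by
  have h1 : ‖z‖ ≤ ‖1 + z‖ + ‖(1 : ℂ)‖ := by
    have := norm_sub_le (1 + z) 1
    simpa using this
  rw [norm_one] at h1
  linarith

omit [DecidableRel R] [Fintype ι] in
/-- **The cut-off shifted singleton factors are regulated IN THE FLUCTUATION FIELD with the fresh `(ε_shift, κ)`** ((376) per singleton member;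
`ε^{#X} = ε`, `#X = 1`). [folklore] -/
theorem cutoff_twoLetter_reg (cell : V → Finset ι) {f : Finset V → EuclideanSpace ℝ ι → ℂ} {ε κ₀ κ τ h Ψ : ℝ} (hε : 0 ≤ ε) (hκ₀ : 0 ≤ κ₀)
    (hτ : 0 < τ) (hκ : κ₀ * (1 + τ) ≤ κ) (𝒜 : Finset (Finset V))
    (hS : ∀ X ∈ 𝒜, X.card = 1 → ∀ ζ : EuclideanSpace ℝ ι, ∑ x ∈ X.biUnion cell, ζ x ^ 2 ≤ h ^ 2 → ‖f X ζ‖ ≤ ε)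
    (hL1 : ∀ X ∈ 𝒜, X.card = 1 → ∀ ζ : EuclideanSpace ℝ ι, ‖1 + f X ζ‖ ≤ exp (κ₀ * (∑ x ∈ X.biUnion cell, ζ x ^ 2) / 2))
    (ψ : EuclideanSpace ℝ ι) (hΨ0 : 0 ≤ Ψ) (hΨh : Ψ ≤ h) (hψ : ∀ X ∈ 𝒜, X.card = 1 → ∑ x ∈ X.biUnion cell, ψ x ^ 2 ≤ Ψ ^ 2)
    (X : Finset V) (hX1 : X.card = 1) (ω : EuclideanSpace ℝ ι) :
    ‖(if X ∈ 𝒜 then f X (ω + ψ) else 0)‖ ≤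
      (ε + 2 * Real.exp (κ₀ * (1 + τ⁻¹) * Ψ ^ 2 / 2) * Real.exp (-((κ - κ₀ * (1 + τ)) * (h - Ψ) ^ 2 / 2))) ^ X.card *
        exp (κ * (∑ x ∈ X.biUnion cell, ω x ^ 2) / 2) := by
  rw [hX1, pow_one]
  split_ifs with hX
  · refine twoLetter_shift_regulated (X.biUnion cell) hε zero_le_two hκ₀ hτ hκ (hS X hX hX1) (fun ζ => ?_) ψ hΨ0 hΨh (hψ X hX hX1) ω
    exact norm_le_two_mul_of_stability (hL1 X hX hX1 ζ) (one_le_exp (by positivity))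
  · rw [norm_zero]; exact mul_nonneg (eps_shift_nonneg hε zero_le_two) (exp_pos _).le

omit [DecidableRel R] [Fintype ι] [DecidableEq ι] in
/-- The cut-off shifted non-singleton factors are sup-small with `ε_shift^{#X}` (`ε ≤ ε_shift`). [folklore] -/
theorem cutoff_twoLetter_sup {f : Finset V → EuclideanSpace ℝ ι → ℂ} {ε κ₀ κ τ h Ψ : ℝ} (hε : 0 ≤ ε) (𝒜 : Finset (Finset V))
    (hsup : ∀ X ∈ 𝒜, X.card ≠ 1 → ∀ ζ : EuclideanSpace ℝ ι, ‖f X ζ‖ ≤ ε ^ X.card) (ψ : EuclideanSpace ℝ ι) (X : Finset V)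
    (hX1 : X.card ≠ 1) (ω : EuclideanSpace ℝ ι) :
    ‖(if X ∈ 𝒜 then f X (ω + ψ) else 0)‖ ≤
      (ε + 2 * Real.exp (κ₀ * (1 + τ⁻¹) * Ψ ^ 2 / 2) * Real.exp (-((κ - κ₀ * (1 + τ)) * (h - Ψ) ^ 2 / 2))) ^ X.card := by
  have hle : ε ≤ ε + 2 * Real.exp (κ₀ * (1 + τ⁻¹) * Ψ ^ 2 / 2) * Real.exp (-((κ - κ₀ * (1 + τ)) * (h - Ψ) ^ 2 / 2)) :=
    le_add_of_nonneg_right (by positivity)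
  split_ifs with hX
  · exact (hsup X hX hX1 (ω + ψ)).trans (pow_le_pow_left₀ hε hle _)
  · rw [norm_zero]; exact pow_nonneg (eps_shift_nonneg hε zero_le_two) _

/-! ## §2. Stability with constant one -/

omit [DecidableRel R] [Fintype ι] in
/-- **POINTWISE STABILITY WITH CONSTANT ONE**: disjoint cells; singleton members with (L1), the others sup-small (`0 ≤ ε`); `0 ≤ κ₀`, `0 < τ` ⟹
`‖∏_{X∈𝒜}(1 + f_X(ω+ψ))‖ ≤ S₂·e^{½κ₀(1+τ⁻¹)Q_U(ψ)}·e^{½κ₀(1+τ)Q_U(ω)}`, `S₂ = ∏_{X∈𝒜,#X≠1}(1 + ε^{#X})`. [folklore] -/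
theorem norm_prod_one_add_shifted_le_twoLetter (cell : V → Finset ι) (hdisj : ∀ p q, p ≠ q → Disjoint (cell p) (cell q))
    {f : Finset V → EuclideanSpace ℝ ι → ℂ} {ε κ₀ τ : ℝ} (hκ₀ : 0 ≤ κ₀) (hτ : 0 < τ) (𝒜 : Finset (Finset V))
    (hL1 : ∀ X ∈ 𝒜, X.card = 1 → ∀ ζ : EuclideanSpace ℝ ι, ‖1 + f X ζ‖ ≤ exp (κ₀ * (∑ x ∈ X.biUnion cell, ζ x ^ 2) / 2))
    (hsup : ∀ X ∈ 𝒜, X.card ≠ 1 → ∀ ζ : EuclideanSpace ℝ ι, ‖f X ζ‖ ≤ ε ^ X.card) (ψ ω : EuclideanSpace ℝ ι) :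
    ‖∏ X ∈ 𝒜, (1 + f X (ω + ψ))‖ ≤ (∏ X ∈ 𝒜 with ¬ X.card = 1, (1 + ε ^ X.card)) *
      (exp (κ₀ * (1 + τ⁻¹) * (∑ x ∈ ((𝒜.filter fun X => X.card = 1).biUnion id).biUnion cell, ψ x ^ 2) / 2) *
        exp (κ₀ * (1 + τ) * (∑ x ∈ ((𝒜.filter fun X => X.card = 1).biUnion id).biUnion cell, ω x ^ 2) / 2)) := by
  set 𝒜₁ := 𝒜.filter fun X => X.card = 1 with h𝒜₁
  have hpw : ∀ X ∈ 𝒜₁, ∀ Y ∈ 𝒜₁, X ≠ Y → Disjoint X Y := by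
    intro X hX Y hY hXY
    obtain ⟨a, rfl⟩ := card_eq_one.1 (mem_filter.1 hX).2
    obtain ⟨b, rfl⟩ := card_eq_one.1 (mem_filter.1 hY).2
    rw [disjoint_singleton_left, mem_singleton]
    exact fun hab => hXY (by rw [hab])
  have hpd := biUnion_cells_pairwiseDisjoint cell hdisj hpw
  have hSψ : ∑ x ∈ (𝒜₁.biUnion id).biUnion cell, ψ x ^ 2 = ∑ X ∈ 𝒜₁, ∑ x ∈ X.biUnion cell, ψ x ^ 2 := by
    rw [Finset.biUnion_biUnion]; simp only [id_eq]; exact sum_biUnion hpd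
  have hSω : ∑ x ∈ (𝒜₁.biUnion id).biUnion cell, ω x ^ 2 = ∑ X ∈ 𝒜₁, ∑ x ∈ X.biUnion cell, ω x ^ 2 := by
    rw [Finset.biUnion_biUnion]; simp only [id_eq]; exact sum_biUnion hpd
  -- one singleton: `‖1 + f_X(ω+ψ)‖ ≤ e^{½κ₀Q_X(ω+ψ)} ≤ e^{½κ₀(1+τ⁻¹)Q_X(ψ)}e^{½κ₀(1+τ)Q_X(ω)}`
  have hone : ∀ X ∈ 𝒜₁, ‖1 + f X (ω + ψ)‖ ≤ exp (κ₀ * (1 + τ⁻¹) * (∑ x ∈ X.biUnion cell, ψ x ^ 2) / 2) *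
      exp (κ₀ * (1 + τ) * (∑ x ∈ X.biUnion cell, ω x ^ 2) / 2) := by
    intro X hX
    have h := hL1 X (mem_filter.1 hX).1 (mem_filter.1 hX).2 (ω + ψ)
    have hsum : ∑ x ∈ X.biUnion cell, (ω + ψ) x ^ 2 = ∑ x ∈ X.biUnion cell, (ω x + ψ x) ^ 2 :=
      sum_congr rfl fun x _ => by simp only [WithLp.ofLp_add, Pi.add_apply]
    rw [hsum] at h
    have hy := sum_add_sq_le (X.biUnion cell) (fun x => ω x) (fun x => ψ x) hτ
    refine h.trans ?_
    rw [← exp_add]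
    refine exp_le_exp.2 ?_
    have := mul_le_mul_of_nonneg_left hy hκ₀
    nlinarith [this]
  rw [← prod_filter_mul_prod_filter_not 𝒜 (fun X => X.card = 1) (fun X => 1 + f X (ω + ψ)), norm_mul]
  have h1 : ‖∏ X ∈ 𝒜₁, (1 + f X (ω + ψ))‖ ≤ exp (κ₀ * (1 + τ⁻¹) * (∑ x ∈ (𝒜₁.biUnion id).biUnion cell, ψ x ^ 2) / 2) *
      exp (κ₀ * (1 + τ) * (∑ x ∈ (𝒜₁.biUnion id).biUnion cell, ω x ^ 2) / 2) := by
    rw [norm_prod]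
    calc ∏ X ∈ 𝒜₁, ‖1 + f X (ω + ψ)‖ ≤ ∏ X ∈ 𝒜₁, (exp (κ₀ * (1 + τ⁻¹) * (∑ x ∈ X.biUnion cell, ψ x ^ 2) / 2) *
          exp (κ₀ * (1 + τ) * (∑ x ∈ X.biUnion cell, ω x ^ 2) / 2)) := prod_le_prod (fun X _ => norm_nonneg _) hone
      _ = exp (κ₀ * (1 + τ⁻¹) * (∑ x ∈ (𝒜₁.biUnion id).biUnion cell, ψ x ^ 2) / 2) *
          exp (κ₀ * (1 + τ) * (∑ x ∈ (𝒜₁.biUnion id).biUnion cell, ω x ^ 2) / 2) := by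
          rw [prod_mul_distrib, ← Real.exp_sum, ← Real.exp_sum, hSψ, hSω, mul_sum, mul_sum, sum_div, sum_div]
  have h2 : ‖∏ X ∈ 𝒜 with ¬ X.card = 1, (1 + f X (ω + ψ))‖ ≤ ∏ X ∈ 𝒜 with ¬ X.card = 1, (1 + ε ^ X.card) := by
    rw [norm_prod]
    exact prod_le_prod (fun X _ => norm_nonneg _) fun X hX => norm_one_add_shifted_sup_le (hsup X (mem_filter.1 hX).1 (mem_filter.1 hX).2) ψ ω
  calc ‖∏ X ∈ 𝒜₁, (1 + f X (ω + ψ))‖ * ‖∏ X ∈ 𝒜 with ¬ X.card = 1, (1 + f X (ω + ψ))‖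
      ≤ (exp (κ₀ * (1 + τ⁻¹) * (∑ x ∈ (𝒜₁.biUnion id).biUnion cell, ψ x ^ 2) / 2) *
          exp (κ₀ * (1 + τ) * (∑ x ∈ (𝒜₁.biUnion id).biUnion cell, ω x ^ 2) / 2)) *
        ∏ X ∈ 𝒜 with ¬ X.card = 1, (1 + ε ^ X.card) := mul_le_mul h1 h2 (norm_nonneg _) (by positivity)
    _ = _ := by ring

omit [DecidableRel R] in
/-- **STABILITY OF THE UNEXPANDED BLOCK INTEGRAL WITH CONSTANT `S₂·A₀^{#cells}`, FOR EVERY EXTERNAL FIELD**: `Γ ⪰ 0`, `Γ ⪯ γ_op·1`, diagonal `≤ γ`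
(`γ ≥ 0`); disjoint cells; members of `𝒜` inside `D`; singletons with (L1), the others sup-small (`0 ≤ ε`); `0 ≤ κ₀`, `0 < τ`, `0 < θ₀ < 1`,
`κ₀(1+τ)γ_op ≤ θ₀` ⟹
`‖Z_ψ(𝒜)‖ ≤ S₂·A₀^{#cells D}·e^{½κ₀(1+τ⁻¹)Σ_{cells D}ψ²}`, `A₀ = (1−θ₀)^{−κ₀(1+τ)γ∕(2θ₀)}`. [folklore] -/
theorem norm_pertZ_shifted_le_twoLetter {Γ : Matrix ι ι ℝ} {γop γ : ℝ} (hΓ : Γ.PosSemidef) (hΓop : (γop • (1 : Matrix ι ι ℝ) - Γ).PosSemidef)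
    (hdiag : ∀ i, Γ i i ≤ γ) (hγ : 0 ≤ γ) (cell : V → Finset ι) (hdisj : ∀ p q, p ≠ q → Disjoint (cell p) (cell q))
    {f : Finset V → EuclideanSpace ℝ ι → ℂ} {ε κ₀ τ θ₀ : ℝ} (hε : 0 ≤ ε) (hκ₀ : 0 ≤ κ₀) (hτ : 0 < τ) (hθ0 : 0 < θ₀) (hθ1 : θ₀ < 1)
    (hκθ : κ₀ * (1 + τ) * γop ≤ θ₀) (𝒜 : Finset (Finset V)) {D : Finset V} (h𝒜D : ∀ X ∈ 𝒜, X ⊆ D)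
    (hL1 : ∀ X ∈ 𝒜, X.card = 1 → ∀ ζ : EuclideanSpace ℝ ι, ‖1 + f X ζ‖ ≤ exp (κ₀ * (∑ x ∈ X.biUnion cell, ζ x ^ 2) / 2))
    (hsup : ∀ X ∈ 𝒜, X.card ≠ 1 → ∀ ζ : EuclideanSpace ℝ ι, ‖f X ζ‖ ≤ ε ^ X.card) (ψ : EuclideanSpace ℝ ι) :
    ‖pertZ (multivariateGaussian 0 Γ) (fun X ω => f X (ω + ψ)) 𝒜‖ ≤ (∏ X ∈ 𝒜 with ¬ X.card = 1, (1 + ε ^ X.card)) *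
      ((1 - θ₀) ^ (-(κ₀ * (1 + τ) * γ / (2 * θ₀)))) ^ (D.biUnion cell).card *
        exp (κ₀ * (1 + τ⁻¹) * (∑ x ∈ D.biUnion cell, ψ x ^ 2) / 2) := by
  set μ := multivariateGaussian 0 Γ with hμ
  set U := ((𝒜.filter fun X => X.card = 1).biUnion id).biUnion cell with hU
  set S₂ : ℝ := ∏ X ∈ 𝒜 with ¬ X.card = 1, (1 + ε ^ X.card) with hS
  set A : ℝ := (1 - θ₀) ^ (-(κ₀ * (1 + τ) * γ / (2 * θ₀))) with hA
  have hκ' : 0 ≤ κ₀ * (1 + τ) := by positivity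
  have hκγ : 0 ≤ κ₀ * (1 + τ) * γ := by positivity
  have hA1 : 1 ≤ A := one_le_regulatorCost hκγ hθ0 hθ1
  have hS0 : 0 ≤ S₂ := prod_nonneg fun X _ => add_nonneg zero_le_one (pow_nonneg hε _)
  have hUD : U ⊆ D.biUnion cell := singletonCells_subset cell h𝒜D
  have hint := integrable_exp_half_sq_on hΓ hΓop hκ' hθ1 hκθ U
  have hgauss := integral_exp_half_sq_on_le hΓ hΓop hκ' hθ0 hθ1 hκθ U fun i _ => hdiag i
  have hψUD : ∑ x ∈ U, ψ x ^ 2 ≤ ∑ x ∈ D.biUnion cell, ψ x ^ 2 :=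
    sum_le_sum_of_subset_of_nonneg hUD (f := fun x => ψ x ^ 2) fun x _ _ => sq_nonneg (ψ x)
  set Eψ : ℝ := exp (κ₀ * (1 + τ⁻¹) * (∑ x ∈ U, ψ x ^ 2) / 2) with hEψ
  have hED : Eψ ≤ exp (κ₀ * (1 + τ⁻¹) * (∑ x ∈ D.biUnion cell, ψ x ^ 2) / 2) := by
    refine exp_le_exp.2 ?_
    have h1 : 0 ≤ κ₀ * (1 + τ⁻¹) := by positivity
    have := mul_le_mul_of_nonneg_left hψUD h1
    linarith
  unfold pertZ
  calc ‖∫ ω, ∏ X ∈ 𝒜, (1 + f X (ω + ψ)) ∂μ‖ ≤ ∫ ω, ‖∏ X ∈ 𝒜, (1 + f X (ω + ψ))‖ ∂μ := norm_integral_le_integral_norm _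
    _ ≤ ∫ ω, S₂ * Eψ * exp (κ₀ * (1 + τ) * (∑ x ∈ U, ω x ^ 2) / 2) ∂μ := by
        refine integral_mono_of_nonneg (ae_of_all _ fun _ => norm_nonneg _) (hint.const_mul _) (ae_of_all _ fun ω => ?_)
        have h := norm_prod_one_add_shifted_le_twoLetter cell hdisj hκ₀ hτ 𝒜 hL1 hsup ψ ω
        rw [← hU] at h
        calc ‖∏ X ∈ 𝒜, (1 + f X (ω + ψ))‖ ≤ S₂ * (Eψ * exp (κ₀ * (1 + τ) * (∑ x ∈ U, ω x ^ 2) / 2)) := h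
          _ = S₂ * Eψ * exp (κ₀ * (1 + τ) * (∑ x ∈ U, ω x ^ 2) / 2) := by ring
    _ = S₂ * Eψ * ∫ ω, exp (κ₀ * (1 + τ) * (∑ x ∈ U, ω x ^ 2) / 2) ∂μ := integral_const_mul _ _
    _ ≤ S₂ * Eψ * A ^ U.card := mul_le_mul_of_nonneg_left hgauss (by positivity)
    _ ≤ S₂ * exp (κ₀ * (1 + τ⁻¹) * (∑ x ∈ D.biUnion cell, ψ x ^ 2) / 2) * A ^ (D.biUnion cell).card :=
        mul_le_mul (mul_le_mul_of_nonneg_left hED hS0) (pow_le_pow_right₀ hA1 (card_le_card hUD)) (by positivity) (by positivity)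
    _ = S₂ * A ^ (D.biUnion cell).card * exp (κ₀ * (1 + τ⁻¹) * (∑ x ∈ D.biUnion cell, ψ x ^ 2) / 2) := by ring

/-! ## §3. Small fields without `e^{κΨ²}` -/

/-- **SMALL FIELDS IN THE TWO-LETTER FORMAT**: `Γ ⪰ 0` of range `ρ` for `dι`, `Γ ⪯ γ_op·1`, diagonal `≤ γ` (`γ ≥ 0`); disjoint cells of `≤ v` sites;
`R` symmetric covering `ρ`-closeness with `≤ Δ` neighbours; members of `𝒜` `R`-connected, cell-measurable, singletons with (S) (`0 < ε`, radius `h`)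
and (L1) (rate `κ₀ ≥ 0`), the others sup-small; a FRESH rate `κ ≥ κ₀(1+τ)` with `κγ_op ≤ θ`, `0 < θ < 1`, `0 < τ`; the external field with
`Σ_{cells X}ψ² ≤ Ψ²` on the singleton members, `0 ≤ Ψ ≤ h`; `e·ε₁·(Δ+1)² ≤ 1∕2` and `η := #(⋃𝒜)(Δ+1)2e·ε₁ ≤ 1∕2` with `ε₁ = 2e(Δ+1)²·ε_shift·A^v`
⟹ `‖Z_ψ(𝒜) − 1‖ ≤ 2η`. [folklore] -/
theorem norm_pertZ_shifted_sub_one_le_twoLetter {Γ : Matrix ι ι ℝ} {γop γ : ℝ} (hΓ : Γ.PosSemidef)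
    (hΓop : (γop • (1 : Matrix ι ι ℝ) - Γ).PosSemidef) (hdiag : ∀ i, Γ i i ≤ γ) (hγ : 0 ≤ γ) {dι : ι → ι → ℕ} {ρ : ℕ}
    (hfr : HasFiniteRange dι ρ Γ) (cell : V → Finset ι) (hdisj : ∀ p q, p ≠ q → Disjoint (cell p) (cell q)) {v : ℕ}
    (hv : ∀ p, (cell p).card ≤ v) (hRsymm : ∀ x y, R x y → R y x)
    (hR : ∀ (p p' : V) (x y : ι), x ∈ cell p → y ∈ cell p' → dι x y ≤ ρ → p = p' ∨ R p p')
    (hΔ : ∀ x, (nbr x).card ≤ Δ) (hnbr : ∀ x y, R x y → y ∈ nbr x)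
    {f : Finset V → EuclideanSpace ℝ ι → ℂ} {ε κ₀ κ τ θ h Ψ : ℝ} (hε : 0 < ε) (hκ₀ : 0 ≤ κ₀) (hτ : 0 < τ) (hκ : κ₀ * (1 + τ) ≤ κ)
    (hθ0 : 0 < θ) (hθ1 : θ < 1) (hκθ : κ * γop ≤ θ) (𝒜 : Finset (Finset V)) (hconn : ∀ X ∈ 𝒜, IsRConnected R X)
    (hmeas : ∀ X ∈ 𝒜, Measurable[⨆ p ∈ X, MeasurableSpace.comap (fun (ω : EuclideanSpace ℝ ι) (x : cell p) => ω x) inferInstance] (f X))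
    (hS : ∀ X ∈ 𝒜, X.card = 1 → ∀ ζ : EuclideanSpace ℝ ι, ∑ x ∈ X.biUnion cell, ζ x ^ 2 ≤ h ^ 2 → ‖f X ζ‖ ≤ ε)
    (hL1 : ∀ X ∈ 𝒜, X.card = 1 → ∀ ζ : EuclideanSpace ℝ ι, ‖1 + f X ζ‖ ≤ exp (κ₀ * (∑ x ∈ X.biUnion cell, ζ x ^ 2) / 2))
    (hsup : ∀ X ∈ 𝒜, X.card ≠ 1 → ∀ ζ : EuclideanSpace ℝ ι, ‖f X ζ‖ ≤ ε ^ X.card) (ψ : EuclideanSpace ℝ ι) (hΨ0 : 0 ≤ Ψ) (hΨh : Ψ ≤ h)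
    (hψ : ∀ X ∈ 𝒜, X.card = 1 → ∑ x ∈ X.biUnion cell, ψ x ^ 2 ≤ Ψ ^ 2)
    (hsmall : Real.exp 1 * (2 * Real.exp 1 * ((Δ : ℝ) + 1) ^ 2 *
      ((ε + 2 * Real.exp (κ₀ * (1 + τ⁻¹) * Ψ ^ 2 / 2) * Real.exp (-((κ - κ₀ * (1 + τ)) * (h - Ψ) ^ 2 / 2))) *
        ((1 - θ) ^ (-(κ * γ / (2 * θ)))) ^ v)) * ((Δ : ℝ) + 1) ^ 2 ≤ 1 / 2)
    (hη : (𝒜.biUnion id).card * ((Δ : ℝ) + 1) * (2 * (Real.exp 1 * (2 * Real.exp 1 * ((Δ : ℝ) + 1) ^ 2 *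
      ((ε + 2 * Real.exp (κ₀ * (1 + τ⁻¹) * Ψ ^ 2 / 2) * Real.exp (-((κ - κ₀ * (1 + τ)) * (h - Ψ) ^ 2 / 2))) *
        ((1 - θ) ^ (-(κ * γ / (2 * θ)))) ^ v)))) ≤ 1 / 2) :
    ‖pertZ (multivariateGaussian 0 Γ) (fun X ω => f X (ω + ψ)) 𝒜 - 1‖ ≤
      2 * ((𝒜.biUnion id).card * ((Δ : ℝ) + 1) * (2 * (Real.exp 1 * (2 * Real.exp 1 * ((Δ : ℝ) + 1) ^ 2 *
        ((ε + 2 * Real.exp (κ₀ * (1 + τ⁻¹) * Ψ ^ 2 / 2) * Real.exp (-((κ - κ₀ * (1 + τ)) * (h - Ψ) ^ 2 / 2))) *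
          ((1 - θ) ^ (-(κ * γ / (2 * θ)))) ^ v))))) := by
  have hκ0 : 0 ≤ κ := le_trans (by positivity) hκ
  have hεs : 0 ≤ ε + 2 * Real.exp (κ₀ * (1 + τ⁻¹) * Ψ ^ 2 / 2) * Real.exp (-((κ - κ₀ * (1 + τ)) * (h - Ψ) ^ 2 / 2)) :=
    eps_shift_nonneg hε.le zero_le_two
  have hA1 : 1 ≤ (1 - θ) ^ (-(κ * γ / (2 * θ))) := one_le_regulatorCost (mul_nonneg hκ0 hγ) hθ0 hθ1
  have hε'' : 0 < (ε + 2 * Real.exp (κ₀ * (1 + τ⁻¹) * Ψ ^ 2 / 2) * Real.exp (-((κ - κ₀ * (1 + τ)) * (h - Ψ) ^ 2 / 2))) *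
      ((1 - θ) ^ (-(κ * γ / (2 * θ)))) ^ v :=
    mul_pos (lt_of_lt_of_le hε (le_add_of_nonneg_right (by positivity))) (pow_pos (lt_of_lt_of_le one_pos hA1) _)
  -- the cut-off shifted factors meet the Gaussian hypotheses with `(ε_shift, κ)` in the fluctuation field
  obtain ⟨hle, hindep, hint, hM, -⟩ := gaussian_set_hypotheses hΓ hΓop hdiag hγ hfr cell hdisj hv hR hεs hκ0 hθ0 hθ1 hκθ
    (cutoff_shifted_measurable_sets cell 𝒜 hmeas ψ)
    (fun X hX1 ω => cutoff_twoLetter_reg cell hε.le hκ₀ hτ hκ 𝒜 hS hL1 ψ hΨ0 hΨh hψ X hX1 ω)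
    (fun X hX1 ω => cutoff_twoLetter_sup hε.le 𝒜 hsup ψ X hX1 ω)
  have hexp := exp_setLogZ_linear hRsymm hΔ hnbr hle hindep (cutoff_shifted_measurable_sets cell 𝒜 hmeas ψ) hint 𝒜 hconn hε''
    (fun 𝒜' _ => hM 𝒜') hsmall
  have hlog := norm_setLogZ_le_linear hRsymm hΔ hnbr 𝒜 hconn hε'' (fun 𝒜' _ => hM 𝒜') hsmall
  rw [pertZ_cutoff] at hexp
  rw [← hexp]
  refine (Complex.norm_exp_sub_one_le (hlog.trans (hη.trans (by norm_num)))).trans ?_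
  linarith

/-! ## §4. THE END: the normalised next factor has the same two letters -/

omit [DecidableEq V] [DecidableRel R] [Fintype ι] [DecidableEq ι] in
/-- The normaliser is `≥ 1`. [folklore] -/
theorem one_le_normaliser {S₂ A : ℝ} {n : ℕ} (hS : 1 ≤ S₂) (hA : 1 ≤ A) : 1 ≤ S₂ * A ^ n := one_le_mul_of_one_le_of_one_le hS (one_le_pow₀ hA)

omit [DecidableEq V] [DecidableRel R] [Fintype ι] [DecidableEq ι] in
/-- `1 ≤ S₂ = ∏(1 + ε^{#X})` for `0 ≤ ε`. [folklore] -/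
theorem one_le_S₂ {ε : ℝ} (hε : 0 ≤ ε) (𝒜 : Finset (Finset V)) : 1 ≤ ∏ X ∈ 𝒜 with ¬ X.card = 1, ((1 : ℝ) + ε ^ X.card) :=
  one_le_prod fun _ _ => le_add_of_nonneg_right (pow_nonneg hε _)

omit [DecidableRel R] in
/-- **(L1⁺) THE NORMALISED NEXT FACTOR HAS THE STABILITY LETTER WITH CONSTANT ONE, FOR EVERY FIELD**: with `N_D = S₂·A₀^{#cells D}`,
`‖Z_ψ(𝒜)∕N_D‖ ≤ e^{½κ₀(1+τ⁻¹)Σ_{cells D}ψ²}` — i.e. `‖1 + g̃⁺_D(ψ)‖ ≤ e^{½κ₀⁺Σ_{cell' }ψ²}` with `κ₀⁺ = κ₀(1+τ⁻¹)`. [folklore] -/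
theorem nextTwoLetter_L1 {Γ : Matrix ι ι ℝ} {γop γ : ℝ} (hΓ : Γ.PosSemidef) (hΓop : (γop • (1 : Matrix ι ι ℝ) - Γ).PosSemidef)
    (hdiag : ∀ i, Γ i i ≤ γ) (hγ : 0 ≤ γ) (cell : V → Finset ι) (hdisj : ∀ p q, p ≠ q → Disjoint (cell p) (cell q))
    {f : Finset V → EuclideanSpace ℝ ι → ℂ} {ε κ₀ τ θ₀ : ℝ} (hε : 0 ≤ ε) (hκ₀ : 0 ≤ κ₀) (hτ : 0 < τ) (hθ0 : 0 < θ₀) (hθ1 : θ₀ < 1)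
    (hκθ : κ₀ * (1 + τ) * γop ≤ θ₀) (𝒜 : Finset (Finset V)) {D : Finset V} (h𝒜D : ∀ X ∈ 𝒜, X ⊆ D)
    (hL1 : ∀ X ∈ 𝒜, X.card = 1 → ∀ ζ : EuclideanSpace ℝ ι, ‖1 + f X ζ‖ ≤ exp (κ₀ * (∑ x ∈ X.biUnion cell, ζ x ^ 2) / 2))
    (hsup : ∀ X ∈ 𝒜, X.card ≠ 1 → ∀ ζ : EuclideanSpace ℝ ι, ‖f X ζ‖ ≤ ε ^ X.card) (ψ : EuclideanSpace ℝ ι) :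
    ‖pertZ (multivariateGaussian 0 Γ) (fun X ω => f X (ω + ψ)) 𝒜 /
        (((∏ X ∈ 𝒜 with ¬ X.card = 1, ((1 : ℝ) + ε ^ X.card)) *
          ((1 - θ₀) ^ (-(κ₀ * (1 + τ) * γ / (2 * θ₀)))) ^ (D.biUnion cell).card : ℝ) : ℂ)‖ ≤
      exp (κ₀ * (1 + τ⁻¹) * (∑ x ∈ D.biUnion cell, ψ x ^ 2) / 2) := by
  have hκγ : 0 ≤ κ₀ * (1 + τ) * γ := by positivity
  have hN1 : 1 ≤ (∏ X ∈ 𝒜 with ¬ X.card = 1, ((1 : ℝ) + ε ^ X.card)) *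
      ((1 - θ₀) ^ (-(κ₀ * (1 + τ) * γ / (2 * θ₀)))) ^ (D.biUnion cell).card :=
    one_le_normaliser (one_le_S₂ hε 𝒜) (one_le_regulatorCost hκγ hθ0 hθ1)
  have hN0 : 0 < (∏ X ∈ 𝒜 with ¬ X.card = 1, ((1 : ℝ) + ε ^ X.card)) *
      ((1 - θ₀) ^ (-(κ₀ * (1 + τ) * γ / (2 * θ₀)))) ^ (D.biUnion cell).card := lt_of_lt_of_le one_pos hN1
  rw [norm_div, Complex.norm_real, Real.norm_eq_abs, abs_of_pos hN0, div_le_iff₀ hN0]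
  have h := norm_pertZ_shifted_le_twoLetter hΓ hΓop hdiag hγ cell hdisj hε hκ₀ hτ hθ0 hθ1 hκθ 𝒜 h𝒜D hL1 hsup ψ
  linarith [h]

/-- **(S⁺) THE NORMALISED NEXT FACTOR IS SMALL ON SMALL FIELDS**: under the hypotheses of `norm_pertZ_shifted_sub_one_le_twoLetter` and the
stability margin of `nextTwoLetter_L1`: `‖Z_ψ(𝒜)∕N_D − 1‖ ≤ 2η + (1 − N_D⁻¹)`. [folklore] -/
theorem nextTwoLetter_S {Γ : Matrix ι ι ℝ} {γop γ : ℝ} (hΓ : Γ.PosSemidef)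
    (hΓop : (γop • (1 : Matrix ι ι ℝ) - Γ).PosSemidef) (hdiag : ∀ i, Γ i i ≤ γ) (hγ : 0 ≤ γ) {dι : ι → ι → ℕ} {ρ : ℕ}
    (hfr : HasFiniteRange dι ρ Γ) (cell : V → Finset ι) (hdisj : ∀ p q, p ≠ q → Disjoint (cell p) (cell q)) {v : ℕ}
    (hv : ∀ p, (cell p).card ≤ v) (hRsymm : ∀ x y, R x y → R y x)
    (hR : ∀ (p p' : V) (x y : ι), x ∈ cell p → y ∈ cell p' → dι x y ≤ ρ → p = p' ∨ R p p')
    (hΔ : ∀ x, (nbr x).card ≤ Δ) (hnbr : ∀ x y, R x y → y ∈ nbr x)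
    {f : Finset V → EuclideanSpace ℝ ι → ℂ} {ε κ₀ κ τ θ θ₀ h Ψ : ℝ} (hε : 0 < ε) (hκ₀ : 0 ≤ κ₀) (hτ : 0 < τ) (hκ : κ₀ * (1 + τ) ≤ κ)
    (hθ0 : 0 < θ) (hθ1 : θ < 1) (hκθ : κ * γop ≤ θ) (hθ₀0 : 0 < θ₀) (hθ₀1 : θ₀ < 1)
    (𝒜 : Finset (Finset V)) (hconn : ∀ X ∈ 𝒜, IsRConnected R X) (D : Finset V)
    (hmeas : ∀ X ∈ 𝒜, Measurable[⨆ p ∈ X, MeasurableSpace.comap (fun (ω : EuclideanSpace ℝ ι) (x : cell p) => ω x) inferInstance] (f X))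
    (hS : ∀ X ∈ 𝒜, X.card = 1 → ∀ ζ : EuclideanSpace ℝ ι, ∑ x ∈ X.biUnion cell, ζ x ^ 2 ≤ h ^ 2 → ‖f X ζ‖ ≤ ε)
    (hL1 : ∀ X ∈ 𝒜, X.card = 1 → ∀ ζ : EuclideanSpace ℝ ι, ‖1 + f X ζ‖ ≤ exp (κ₀ * (∑ x ∈ X.biUnion cell, ζ x ^ 2) / 2))
    (hsup : ∀ X ∈ 𝒜, X.card ≠ 1 → ∀ ζ : EuclideanSpace ℝ ι, ‖f X ζ‖ ≤ ε ^ X.card) (ψ : EuclideanSpace ℝ ι) (hΨ0 : 0 ≤ Ψ) (hΨh : Ψ ≤ h)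
    (hψ : ∀ X ∈ 𝒜, X.card = 1 → ∑ x ∈ X.biUnion cell, ψ x ^ 2 ≤ Ψ ^ 2)
    (hsmall : Real.exp 1 * (2 * Real.exp 1 * ((Δ : ℝ) + 1) ^ 2 *
      ((ε + 2 * Real.exp (κ₀ * (1 + τ⁻¹) * Ψ ^ 2 / 2) * Real.exp (-((κ - κ₀ * (1 + τ)) * (h - Ψ) ^ 2 / 2))) *
        ((1 - θ) ^ (-(κ * γ / (2 * θ)))) ^ v)) * ((Δ : ℝ) + 1) ^ 2 ≤ 1 / 2)
    (hη : (𝒜.biUnion id).card * ((Δ : ℝ) + 1) * (2 * (Real.exp 1 * (2 * Real.exp 1 * ((Δ : ℝ) + 1) ^ 2 *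
      ((ε + 2 * Real.exp (κ₀ * (1 + τ⁻¹) * Ψ ^ 2 / 2) * Real.exp (-((κ - κ₀ * (1 + τ)) * (h - Ψ) ^ 2 / 2))) *
        ((1 - θ) ^ (-(κ * γ / (2 * θ)))) ^ v)))) ≤ 1 / 2) :
    ‖pertZ (multivariateGaussian 0 Γ) (fun X ω => f X (ω + ψ)) 𝒜 /
          (((∏ X ∈ 𝒜 with ¬ X.card = 1, ((1 : ℝ) + ε ^ X.card)) *
            ((1 - θ₀) ^ (-(κ₀ * (1 + τ) * γ / (2 * θ₀)))) ^ (D.biUnion cell).card : ℝ) : ℂ) - 1‖ ≤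
      2 * ((𝒜.biUnion id).card * ((Δ : ℝ) + 1) * (2 * (Real.exp 1 * (2 * Real.exp 1 * ((Δ : ℝ) + 1) ^ 2 *
        ((ε + 2 * Real.exp (κ₀ * (1 + τ⁻¹) * Ψ ^ 2 / 2) * Real.exp (-((κ - κ₀ * (1 + τ)) * (h - Ψ) ^ 2 / 2))) *
          ((1 - θ) ^ (-(κ * γ / (2 * θ)))) ^ v))))) +
      (1 - ((∏ X ∈ 𝒜 with ¬ X.card = 1, ((1 : ℝ) + ε ^ X.card)) *
            ((1 - θ₀) ^ (-(κ₀ * (1 + τ) * γ / (2 * θ₀)))) ^ (D.biUnion cell).card)⁻¹) := by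
  set Z := pertZ (multivariateGaussian 0 Γ) (fun X ω => f X (ω + ψ)) 𝒜 with hZ
  set N : ℝ := (∏ X ∈ 𝒜 with ¬ X.card = 1, ((1 : ℝ) + ε ^ X.card)) *
    ((1 - θ₀) ^ (-(κ₀ * (1 + τ) * γ / (2 * θ₀)))) ^ (D.biUnion cell).card with hN
  set η2 : ℝ := 2 * ((𝒜.biUnion id).card * ((Δ : ℝ) + 1) * (2 * (Real.exp 1 * (2 * Real.exp 1 * ((Δ : ℝ) + 1) ^ 2 *
    ((ε + 2 * Real.exp (κ₀ * (1 + τ⁻¹) * Ψ ^ 2 / 2) * Real.exp (-((κ - κ₀ * (1 + τ)) * (h - Ψ) ^ 2 / 2))) *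
      ((1 - θ) ^ (-(κ * γ / (2 * θ)))) ^ v))))) with hη2
  have hκγ : 0 ≤ κ₀ * (1 + τ) * γ := by positivity
  have hN1 : 1 ≤ N := one_le_normaliser (one_le_S₂ hε.le 𝒜) (one_le_regulatorCost hκγ hθ₀0 hθ₀1)
  have hN0 : 0 < N := lt_of_lt_of_le one_pos hN1
  have hsmallZ : ‖Z - 1‖ ≤ η2 :=
    norm_pertZ_shifted_sub_one_le_twoLetter hΓ hΓop hdiag hγ hfr cell hdisj hv hRsymm hR hΔ hnbr hε hκ₀ hτ hκ hθ0 hθ1 hκθ 𝒜 hconn hmeas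
      hS hL1 hsup ψ hΨ0 hΨh hψ hsmall hη
  have hη2_0 : 0 ≤ η2 := le_trans (norm_nonneg _) hsmallZ
  -- `Z/N − 1 = (Z − 1)/N + (1/N − 1)`
  have hNc0 : (N : ℂ) ≠ 0 := by exact_mod_cast hN0.ne'
  have hsplit : Z / (N : ℂ) - 1 = (Z - 1) / (N : ℂ) + ((1 : ℂ) / (N : ℂ) - 1) := by
    field_simp
    ring
  rw [hsplit]
  have hNc : ‖(N : ℂ)‖ = N := by rw [Complex.norm_real, Real.norm_eq_abs, abs_of_pos hN0]
  have h1 : ‖(Z - 1) / (N : ℂ)‖ ≤ η2 := by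
    rw [norm_div, hNc, div_le_iff₀ hN0]
    exact hsmallZ.trans (le_mul_of_one_le_right hη2_0 hN1)
  have h2 : ‖(1 : ℂ) / (N : ℂ) - 1‖ = 1 - N⁻¹ := by
    have h3 : (1 : ℂ) / (N : ℂ) - 1 = (((1 / N - 1 : ℝ)) : ℂ) := by push_cast; ring
    rw [h3, Complex.norm_real, Real.norm_eq_abs, abs_of_nonpos (by rw [one_div]; linarith [inv_le_one_of_one_le₀ hN1]), one_div]
    ring
  calc ‖(Z - 1) / (N : ℂ) + ((1 : ℂ) / (N : ℂ) - 1)‖ ≤ ‖(Z - 1) / (N : ℂ)‖ + ‖(1 : ℂ) / (N : ℂ) - 1‖ := norm_add_le _ _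
    _ ≤ η2 + (1 - N⁻¹) := add_le_add h1 h2.le

omit [DecidableEq V] [DecidableRel R] [Fintype ι] in
/-- **(α3)'s INPUT DISPLAYED — THE NEXT BALL UNDER A SMOOTHNESS LETTER**: if the next field is smooth on the finer cells of the singleton members
(`Σ_{cells X}ψ² ≤ σ·Σ_{cells D}ψ²` for `X ∈ 𝒜`, `#X = 1`, some `σ > 0`) then the next small-field BALL `Σ_{cells D}ψ² ≤ Ψ²∕σ` lies inside the
region of (S⁺) (`Σ_{cells X}ψ² ≤ Ψ²` on every singleton member). [folklore] -/
theorem nextTwoLetter_S_of_smooth (cell : V → Finset ι) (𝒜 : Finset (Finset V)) (D : Finset V) (ψ : EuclideanSpace ℝ ι) {σ Ψ : ℝ}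
    (hσ : 0 < σ) (hsmooth : ∀ X ∈ 𝒜, X.card = 1 → ∑ x ∈ X.biUnion cell, ψ x ^ 2 ≤ σ * ∑ x ∈ D.biUnion cell, ψ x ^ 2)
    (hball : ∑ x ∈ D.biUnion cell, ψ x ^ 2 ≤ Ψ ^ 2 / σ) :
    ∀ X ∈ 𝒜, X.card = 1 → ∑ x ∈ X.biUnion cell, ψ x ^ 2 ≤ Ψ ^ 2 := fun X hX hX1 =>
  (hsmooth X hX hX1).trans ((mul_le_mul_of_nonneg_left hball hσ.le).trans (le_of_eq (mul_div_cancel₀ _ hσ.ne')))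

/-! ## §5. Toy -/

omit [DecidableEq V] [DecidableRel R] [Fintype ι] [DecidableEq ι] in
/-- Toy (§4): the trivial normaliser (`S₂ = 1`, `A = 1`) is `1 ≥ 1`. -/
example : (1 : ℝ) ≤ 1 * 1 ^ 3 := one_le_normaliser le_rfl le_rfl

end Summit.QuantumFields.BalabanUV.T4Continuum.NE7b.SupTwoLetterNextFactor
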